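import Literature.NumberTheory.Automorphic.Liu2021.AppendixC.EtaleFaltingsTower
import HarnessLib

/-!
# [Liu 2021, §4.3 l. 2154–2160] the Betti–étale comparison IN THE COLIMIT, built from a Betti pinning, a levelwise comparison
# family and an étale Hecke datum induced by the translates (the «comparison half» of `Sec42Data.exists_etaleHeckeDatum_with_bettiComparison`)

Topic `NumberTheory/Automorphic/Liu2021/AppendixC`; namespace `Literature.NumberTheory.Automorphic.Liu2021.AppendixC`.  THEOREMS ONLY
(no `def`, no named fact, no `sorry`; net Literature debt 0).  Continuation of `EtaleBettiComparison.lean` (B-typ04, p595473: the HYPOTHESIS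
structure `Sec42Data.BettiPinning C T τ' H rhoB`, the DATA structure `H1ComparisonFamily τ' ℓ ι`, the predicate `EtaleHeckeDatum.IsInducedBy`,
and the named fact `Sec42Data.exists_etaleHeckeDatum_with_bettiComparison`) and of `EtaleFaltingsTower.lean` (A-p17, p603379: tower
bookkeeping `exists_eq_toTower_baseChange`, `rhoEt_baseChange_comp_toTower`, `toTower_baseChange_injective`, `toTower_baseChange_comp_h1PullBar`).

Cell `hodgecm-mathlib` (D-0151), row VI-2″ of INVENTORY §8.2, FACT-LEVEL residual `stub_etaleComparisonAtFace : EtaleComparisonAtFace` of the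
line `a3_liu418` v4 (de740f8ad3d43177, :569) on the crux item HLiu418 (stmt-HodgeConjecture-24832).  The named fact asks, for a pinned Betti
tower `(H, rhoB, B)`, for THREE things: an étale Hecke datum `X` INDUCED by the translates `T`, a comparison `cmp : C.BettiComparison ℓ X H rhoB ι`,
and a levelwise comparison family `c`, with `cmp ∘ b_K = ([·]_K ⊗ 1) ∘ c_{A_K}`.  THIS FILE proves the middle third from the other two:

**`Sec42Data.BettiPinning.exists_bettiComparison`**: given `B : C.BettiPinning T τ' H rhoB`, `c : H1ComparisonFamily τ' ℓ ι`, and ANY étale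
Hecke datum `X : C.EtaleHeckeDatum ℓ` with `X.IsInducedBy T`, there is `cmp : C.BettiComparison ℓ X H rhoB ι` with
`cmp.cmp (B.b K y) = (C.toTower ℓ K).baseChange ℚ_ℓ^{ac} (c.cmp (C.A K) y)` for every level `K` and class `y` — so that the named fact
follows from «an induced étale Hecke datum exists» (the étale third, rows (I)/(D) of the line: `levelCompat`) and «a comparison family exists»
(`exists_h1ComparisonFamily`, A-p16 p598493 `exists_h1ComparisonFamily_holds`) by `exists_etaleHeckeDatum_with_bettiComparison_of_isInducedBy`.

## The printed text (Y. Liu, arXiv:2102.11518 = Camb. J. Math. 9 (2021), `FJcycle.tex` l. 2152–2160, print pp. 49–50)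

«Take an embedding `τ' : E → ℂ`, a rational prime `ℓ`, and an isomorphism `ι_ℓ : ℂ ≅ ℚ_ℓ^{ac}`. We have a canonical isomorphism
`H¹_ét(A_K ⊗_{E,τ'} ℂ, ℚ_ℓ^{ac}) ≃ H¹_{B,τ'}(A_K, ℂ) ⊗_{ℂ,ι_ℓ} ℚ_ℓ^{ac}` by the comparison theorem. Put `H¹_ét(A_∞ ⊗_{E,τ'} ℂ, ℚ_ℓ^{ac}) :=
colim_K H¹_ét(A_K ⊗_{E,τ'} ℂ, ℚ_ℓ^{ac})`, which is a `ℚ_ℓ^{ac}[Gal(ℂ/τ'(E)) × 𝔾(𝔸_F^∞)]`-module.»  The passage from the LEVELWISE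
comparison (the comparison theorem, `c`) to the comparison OF THE COLIMITS `H¹_{B,τ'}(A_∞, ℂ) ⊗_{ι_ℓ} ℚ_ℓ^{ac} ≃ H¹_ét(A_∞ ⊗ ℂ, ℚ_ℓ^{ac})`
compatibly with the Hecke actions (used at Thm. 4.18 proof l. 2254–2257 «(4.2) induces the following map») is what is formalised here:
the Betti side is presented by the pinning `B` (injective, jointly exhaustive level maps `b_K` with the Hecke law `rhoB g ∘ b_{K'} = b_K ∘ Alb(T_g)^*`),
the étale side by the tree's `Module.DirectLimit` `C.etaleH1Tower ℓ` with `X.rhoEt` induced by the same `Alb(T_g)`; naturality of `c` glues them.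

## Proof (kernel; ≈ [Liu2021] l. 2154–2160 made explicit)

* `levelCmp_pull`: `Λ_{K'} ∘ Alb_u^* = Λ_K` for `K' ⊆ K`, where `Λ_K := ([·]_K ⊗ 1) ∘ c_{A_K}` (naturality of `c` + `toTower_pull`).
* `levelCmp_eq_of_b_eq`: `b_K y = b_{K'} y' ⇒ Λ_K y = Λ_{K'} y'` (common refinement `C5.SmallLevel.exists_le_le`, `b_one`, `albTr_one`, `b_injective`).
* the map `cmp : H →ₛₗ[ι] ℚ_ℓ^{ac} ⊗ H¹_ét(A_∞)` is `x = b_K y ↦ Λ_K y` (well defined by the previous bullet; additive and `ι`-semilinear levelwise);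
  INJECTIVE: shrink the level below the threshold `K₁` of `X.levelCompat`, where `[·]_K ⊗ 1` is injective (`toTower_baseChange_injective`) and
  `c_{A_K}` is; SURJECTIVE: every class of `ℚ_ℓ^{ac} ⊗ H¹_ét(A_∞)` is a level class (`exists_eq_toTower_baseChange`) and `c_{A_K}` is onto;
  HECKE: `rhoB g (b_{K'} y) = b_L (Alb(T_g)^* y)` at the conjugate level `L = gK'g⁻¹ ∩ K₀` (`C5.heckeLevel`, `B.b_hecke`), `c` natural, and
  `(g ⊗ 1) ∘ [·]_{K'} = [·]_L ∘ Alb(T_g)^*` for `X` induced by `T` (`rhoEt_baseChange_comp_toTower`).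

HC_CM is proved only modulo the 7 printed citations until rung 0 closes; this file discharges none of them and is UNCONDITIONAL (no named-fact
hypothesis: `X`, `hX`, `c`, `B` are data ∕ structure hypotheses of the very fact it serves).

## References
* [Liu2021] Y. Liu, *Fourier–Jacobi cycles and arithmetic relative trace formula*, Camb. J. Math. 9 (2021), arXiv:2102.11518: §4.2 l. 2074,
  2079–2081; §4.3 l. 2152–2160; Thm. 4.18 proof l. 2254–2257.
* [SGA4Tome3] M. Artin, A. Grothendieck, J.-L. Verdier, SGA 4 Tome 3, Exp. XI Thm. 4.4 (the levelwise comparison, carried by `c`).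
* [Milne2005ShimuraVarieties] J. Milne, *Introduction to Shimura varieties*, §13 p. 118 (the translates `T(g)`, conjugate level).
* Tree: `AppendixC.EtaleBettiComparison` (p595473), `AppendixC.EtaleFaltingsTower` (p603379), `AppendixC.EtaleH1Tower` (p592872),
  `AppendixC.HeckeTranslates`, `AppendixC.RestOneLevelInvariants` (`C5.SmallLevel.exists_le_le`).
-/

noncomputable section

open CategoryTheory NumberField
open scoped TensorProduct

namespace Literature.NumberTheory.Automorphic.Liu2021.AppendixC

open Literature.AlgebraicGeometry.Motives (AbelianVariety)
open Literature.AlgebraicGeometry.Motives.AbelianVariety (rationalTateModuleMap)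

variable {F E : Type} [Field F] [NumberField F] [IsTotallyReal F] [Field E] [NumberField E] [Algebra F E]
  [IsTotallyComplex E] [Algebra.IsQuadraticExtension F E]
variable {P5 : PropC5Data F E} {isotropicAt : ℕ → Prop}

namespace Sec42Data

variable (C : Sec42Data P5 isotropicAt) (ℓ : ℕ) [Fact ℓ.Prime] {τ' : E →+* ℂ} {ι : ℂ ≃+* AlgebraicClosure ℚ_[ℓ]}

/-! ## §1 The level comparison `Λ_K := ([·]_K ⊗ 1) ∘ c_{A_K}` and its compatibility with the transition maps -/

/-- **`Λ_{K'} ∘ Alb_u^* = Λ_K`** for `K' ⊆ K`: the levelwise comparison followed by the canonical map into `ℚ_ℓ^{ac} ⊗ H¹_ét(A_∞)` is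
compatible with pull-back along the Albanese transition maps (naturality of the comparison family + `[·]_{K'} ∘ Alb_u^* = [·]_K`).
[cite: Liu2021, §4.3 (FJcycle.tex l. 2154–2158)] [cite: SGA4Tome3, Exp. XI Thm. 4.4] -/
theorem levelCmp_pull (c : H1ComparisonFamily (E := E) τ' ℓ ι) {K K' : C5.SmallLevel C.S.K₀} (f : K' ⟶ K) (y : C.bettiH1 τ' K) :
    (C.toTower ℓ K').baseChange (AlgebraicClosure ℚ_[ℓ]) (c.cmp (C.A K') (bettiPullAlong τ' (C.Atr f) y)) =
      (C.toTower ℓ K).baseChange (AlgebraicClosure ℚ_[ℓ]) (c.cmp (C.A K) y) := by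
  rw [c.natural (C.Atr f) y, ← h1PullBar_def, ← LinearMap.comp_apply, toTower_baseChange_comp_h1PullBar]

variable {C ℓ} in
/-- The same along `Alb(T_1) : A_{K'} → A_K` for the level condition `K' ⊆ K` at `g = 1` (`HeckeTranslates.albTr_one`).
[cite: Liu2021, §4.2 (FJcycle.tex l. 2070–2074) and §4.3 (l. 2154–2158)] -/
theorem levelCmp_albTr_one (T : C.HeckeTranslates) (c : H1ComparisonFamily (E := E) τ' ℓ ι) {K K' : C5.SmallLevel C.S.K₀}
    (h : C5.HeckeLE (1 : C.G) K' K) (y : C.bettiH1 τ' K) :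
    (C.toTower ℓ K').baseChange (AlgebraicClosure ℚ_[ℓ]) (c.cmp (C.A K') (bettiPullAlong τ' (T.albTr 1 K' K h) y)) =
      (C.toTower ℓ K).baseChange (AlgebraicClosure ℚ_[ℓ]) (c.cmp (C.A K) y) := by
  have hle : K' ≤ K := C5.heckeLE_one_iff.1 h
  have e : T.albTr 1 K' K h = C.Atr (homOfLE hle) := T.albTr_one (homOfLE hle)
  rw [e]
  exact C.levelCmp_pull ℓ c (homOfLE hle) y

namespace BettiPinning

variable {C ℓ} {T : C.HeckeTranslates} {H : Type} [AddCommGroup H] [Module ℂ H] {rhoB : Representation ℂ C.G H}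

/-- **Well-definedness on the pinned tower**: two level representatives of the same class of `H` have the same comparison image,
`b_K y = b_{K'} y' ⇒ Λ_K y = Λ_{K'} y'` (pass to a common refinement `L ⊆ K ∩ K'` with `b_one`, use injectivity of `b_L`, then `levelCmp_albTr_one`).
[cite: Liu2021, §4.2 (FJcycle.tex l. 2079–2081) and §4.3 (l. 2154–2158)] -/
theorem levelCmp_eq_of_b_eq (B : C.BettiPinning T τ' H rhoB) (c : H1ComparisonFamily (E := E) τ' ℓ ι) {K K' : C5.SmallLevel C.S.K₀}
    {y : C.bettiH1 τ' K} {y' : C.bettiH1 τ' K'} (h : B.b K y = B.b K' y') :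
    (C.toTower ℓ K).baseChange (AlgebraicClosure ℚ_[ℓ]) (c.cmp (C.A K) y) =
      (C.toTower ℓ K').baseChange (AlgebraicClosure ℚ_[ℓ]) (c.cmp (C.A K') y') := by
  obtain ⟨L, hLK, hLK'⟩ := C5.SmallLevel.exists_le_le K K'
  have e₁ := B.b_one L K (C5.HeckeLE.one_of_le hLK) y
  have e₂ := B.b_one L K' (C5.HeckeLE.one_of_le hLK') y'
  rw [e₁, e₂] at h
  have h' := B.b_injective L h
  rw [← levelCmp_albTr_one T c (C5.HeckeLE.one_of_le hLK) y, ← levelCmp_albTr_one T c (C5.HeckeLE.one_of_le hLK') y', h']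

/-- **[Liu2021, §4.3 l. 2154–2160] the comparison in the colimit, from a pinning.**  For a Betti tower `(H, rhoB)` pinned to the real levels by
`B`, a levelwise comparison family `c` along `(τ', ι)`, and an étale Hecke datum `X` INDUCED by the translates `T`, there is a Hecke-equivariant
`ι`-semilinear comparison bijection `cmp : H → ℚ_ℓ^{ac} ⊗ H¹_ét(A_∞)` (`C.BettiComparison ℓ X H rhoB ι`) which IS `c` level by level:
`cmp (b_K y) = ([·]_K ⊗ 1) (c_{A_K} y)`.  «We have a canonical isomorphism `H¹_ét(A_∞ ⊗_{E,τ'} ℂ, ℚ_ℓ^{ac}) ⊗_{ℚ_ℓ^{ac},ι_ℓ^{-1}} ℂ ≃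
H¹_{B,τ'}(A_∞, ℂ)` … a `ℚ_ℓ^{ac}[Gal(ℂ/τ'(E)) × 𝔾(𝔸_F^∞)]`-module» — the colimit of the levelwise comparisons.  Unconditional.
[cite: Liu2021, §4.3 (FJcycle.tex l. 2152–2160) and Thm. 4.18 proof (l. 2254–2257)] [cite: SGA4Tome3, Exp. XI Thm. 4.4]
[cite: Milne2005ShimuraVarieties, §13 p. 118 L21–26] -/
theorem exists_bettiComparison (B : C.BettiPinning T τ' H rhoB) (c : H1ComparisonFamily (E := E) τ' ℓ ι) (X : C.EtaleHeckeDatum ℓ)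
    (hX : X.IsInducedBy T) :
    ∃ cmp : C.BettiComparison ℓ X H rhoB ι,
      ∀ (K : C5.SmallLevel C.S.K₀) (y : C.bettiH1 τ' K),
        cmp.cmp (B.b K y) = (C.toTower ℓ K).baseChange (AlgebraicClosure ℚ_[ℓ]) (c.cmp (C.A K) y) := by
  classical
  -- a chosen level representative `x = b_{K x} (y x)` of every class of `H`
  choose Kx yx hxy using B.exhaust
  -- the comparison map on representatives and its independence of the representative
  let f : H → AlgebraicClosure ℚ_[ℓ] ⊗[ℚ_[ℓ]] C.etaleH1Tower ℓ := fun x =>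
    (C.toTower ℓ (Kx x)).baseChange (AlgebraicClosure ℚ_[ℓ]) (c.cmp (C.A (Kx x)) (yx x))
  have hf : ∀ (K : C5.SmallLevel C.S.K₀) (y : C.bettiH1 τ' K),
      f (B.b K y) = (C.toTower ℓ K).baseChange (AlgebraicClosure ℚ_[ℓ]) (c.cmp (C.A K) y) := fun K y =>
    B.levelCmp_eq_of_b_eq c (hxy (B.b K y))
  -- two classes at a common level
  have common : ∀ x₁ x₂ : H, ∃ (L : C5.SmallLevel C.S.K₀) (z₁ z₂ : C.bettiH1 τ' L), B.b L z₁ = x₁ ∧ B.b L z₂ = x₂ := by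
    intro x₁ x₂
    obtain ⟨K₁, y₁, rfl⟩ := B.exhaust x₁
    obtain ⟨K₂, y₂, rfl⟩ := B.exhaust x₂
    obtain ⟨L, hL₁, hL₂⟩ := C5.SmallLevel.exists_le_le K₁ K₂
    exact ⟨L, _, _, (B.b_one L K₁ (C5.HeckeLE.one_of_le hL₁) y₁).symm, (B.b_one L K₂ (C5.HeckeLE.one_of_le hL₂) y₂).symm⟩
  -- the `ι`-semilinear comparison map
  let cmp : H →ₛₗ[(ι : ℂ →+* AlgebraicClosure ℚ_[ℓ])] AlgebraicClosure ℚ_[ℓ] ⊗[ℚ_[ℓ]] C.etaleH1Tower ℓ :=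
    { toFun := f
      map_add' := fun x₁ x₂ => by
        obtain ⟨L, z₁, z₂, rfl, rfl⟩ := common x₁ x₂
        rw [← map_add, hf, hf, hf, map_add, map_add]
      map_smul' := fun z x => by
        obtain ⟨K, y, rfl⟩ := B.exhaust x
        rw [← map_smul, hf, hf, LinearMap.map_smulₛₗ, LinearMap.map_smul] }
  have hcmp : ∀ (K : C5.SmallLevel C.S.K₀) (y : C.bettiH1 τ' K),
      cmp (B.b K y) = (C.toTower ℓ K).baseChange (AlgebraicClosure ℚ_[ℓ]) (c.cmp (C.A K) y) := hf
  refine ⟨{ cmp := cmp, bijective := ⟨?_, ?_⟩, comm := ?_ }, hcmp⟩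
  · -- injective: shrink below the threshold of `X.levelCompat`
    obtain ⟨K₁, hK₁⟩ := X.levelCompat
    intro x₁ x₂ h
    obtain ⟨L₀, z₁, z₂, rfl, rfl⟩ := common x₁ x₂
    obtain ⟨L, hLL₀, hLK₁⟩ := C5.SmallLevel.exists_le_le L₀ K₁
    rw [B.b_one L L₀ (C5.HeckeLE.one_of_le hLL₀) z₁, B.b_one L L₀ (C5.HeckeLE.one_of_le hLL₀) z₂] at h ⊢
    rw [hcmp, hcmp] at h
    have hinj := toTower_baseChange_injective C ℓ (hK₁ L hLK₁).1
    exact congrArg (B.b L) ((c.bijective (C.A L)).1 (hinj h))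
  · -- surjective: every class of `ℚ_ℓ^{ac} ⊗ H¹_ét(A_∞)` is a level class, and `c_{A_K}` is onto
    intro v
    obtain ⟨K, -, w, rfl⟩ := exists_eq_toTower_baseChange C ℓ ⟨C.S.K₀, le_rfl⟩ v
    obtain ⟨y, rfl⟩ := (c.bijective (C.A K)).2 w
    exact ⟨B.b K y, hcmp K y⟩
  · -- Hecke equivariance at the conjugate level `gK'g⁻¹ ∩ K₀`
    intro g x
    obtain ⟨K', y, rfl⟩ := B.exhaust x
    have h := C5.heckeLE_heckeLevel g K'
    show cmp (rhoB g (B.b K' y)) = (X.rhoEt g).baseChange (AlgebraicClosure ℚ_[ℓ]) (cmp (B.b K' y))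
    rw [B.b_hecke g (C5.heckeLevel g K') K' h y, hcmp, hcmp, c.natural, ← h1PullBar_def, ← LinearMap.comp_apply,
      ← rhoEt_baseChange_comp_toTower hX g (C5.heckeLevel g K') K' h, LinearMap.comp_apply]

end BettiPinning

/-! ## §2 The named fact from its étale third and the comparison theorem -/

variable {C ℓ} in
/-- **`Sec42Data.exists_etaleHeckeDatum_with_bettiComparison` from an INDUCED étale Hecke datum and a comparison family.**  If some étale Hecke
datum on `H¹_ét(A_∞)` is induced by the translates `T` (the étale third: smoothness and level-compatibility of the induced action — rows (I)/(D)
of the line `a3_liu418`), and the levelwise comparison theorem holds along `(τ', ι)` (`exists_h1ComparisonFamily`), then the named fact holds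
for EVERY pinned Betti tower `(H, rhoB, B)`. [cite: Liu2021, §4.3 (FJcycle.tex l. 2152–2160)] [cite: SGA4Tome3, Exp. XI Thm. 4.4] -/
theorem exists_etaleHeckeDatum_with_bettiComparison_of_isInducedBy {T : C.HeckeTranslates}
    (hX : ∃ X : C.EtaleHeckeDatum ℓ, X.IsInducedBy T) (hc : exists_h1ComparisonFamily (E := E) τ' ℓ ι)
    (H : Type) [AddCommGroup H] [Module ℂ H] (rhoB : Representation ℂ C.G H) (B : C.BettiPinning T τ' H rhoB) :
    C.exists_etaleHeckeDatum_with_bettiComparison ℓ T τ' ι H rhoB B := by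
  obtain ⟨X, hX⟩ := hX
  obtain ⟨c⟩ := hc
  obtain ⟨cmp, hcmp⟩ := B.exists_bettiComparison c X hX
  exact ⟨X, cmp, c, hX, hcmp⟩

end Sec42Data

end Literature.NumberTheory.Automorphic.Liu2021.AppendixC

end
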